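import Summits.QuantumFields.YangMills.Theorems.BalabanLadderNTN32VarianceDefs
import Summits.QuantumFields.YangMills.Theorems.LangevinControlUVOSLegsFromFemtoAndGapStubLowerTwoPointMain
import HarnessLib

/-!
# Crux `NT` (stmt-QuantumFields-19353), line «n32-variance» — the sorry-free glue BY NAME:
# `NT_of : N32T → K3T → Summit.QuantumFields.YangMills.Theses.BalabanLadder.NT`

Landing kit part 2 for the crux-plan line `Cruxes/NT/Lines/n32_variance.lean` (seat `ymfull-r2a-plan-1`, R590-ym item (12)): the line's
§2 (geometry of the bump witnesses; `‖θu − te₀‖ = ‖u + te₀‖` is the tree's `StubLower.norm_timeReflection_sub_single`), §3 (clause (i) of `LowerBounds` from the volume-uniform two-point floor, via the tree's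
`PointwiseFloor.q2Floor_of_pointwise_floor`), §4 (clause (ii) from the signed three-point floor: one-torus signed pigeonhole + Riemann
envelopes `CeilingPrice.tendsto_envelope`), §5 (`lowerBounds_of_floors`, **`NT_of`**) CHARACTER FOR CHARACTER over the landed Defs module
`Theorems/BalabanLadderNTN32VarianceDefs.lean` (namespace `…Cruxes.NT.N32Floors`).  After this file the crux `BalabanLadder.NT` follows BY
NAME from the two named open statements `N32T`, `K3T` through tree theorems only.

HONEST LABEL: implications between OPEN Props + elementary geometry; nothing here proves a floor, the crux NT, a rung, the leaf or any
summit; finite-volume ∕ conditional; the Yang–Mills mass gap is NOT proved.  Prover seat `ymfull-r2a-prover-2` g0 (R590-ym (14)), 2026-08-30.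
-/

set_option autoImplicit false

noncomputable section

open scoped SchwartzMap
open MeasureTheory Filter Topology Metric
open Literature.MathematicalPhysics.QuantumFieldTheory Literature.MathematicalPhysics.QuantumLattice
open Literature.Probability.LatticeModels
open Summit.QuantumFields.YangMills.Cruxes.OSLegsFromFemtoAndGap.DlrCollarTransfer
open Summit.QuantumFields.YangMills.Theorems.OSLegsFromFemtoAndGap.StubLower
  (exists_bump_schwartz abs_apply_le_norm timeReflection_single_zero norm_single_zero siteToE_sub)
open Summit.QuantumFields.YangMills.Cruxes.NT.Reference (tsupport_thetaTest_subset_closedBall_zero)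

namespace Summit.QuantumFields.YangMills.Cruxes.NT.N32Floors

/-! ## §2 Geometry of the witnesses (sorry-free glue) -/

section Geometry

/-- **The reflected cloud sits in a window.**  If `θu` and `w` are within `2ρ` of `p = t₀e₀` (`t₀ ≥ 0`) then
`2t₀ − 4ρ ≤ ‖w − u‖ ≤ 2t₀ + 4ρ`. [folklore] -/
theorem window_of_near {t₀ ρ : ℝ} (ht₀ : 0 ≤ t₀) {u w : EuclideanSpace ℝ (Fin 4)}
    (hu : dist (timeReflection 4 u) (EuclideanSpace.single 0 t₀) < 2 * ρ)
    (hw : dist w (EuclideanSpace.single 0 t₀) < 2 * ρ) :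
    2 * t₀ - 4 * ρ ≤ ‖w - u‖ ∧ ‖w - u‖ ≤ 2 * t₀ + 4 * ρ := by
  set p : EuclideanSpace ℝ (Fin 4) := EuclideanSpace.single 0 t₀ with hp
  rw [dist_eq_norm, Summit.QuantumFields.YangMills.Cruxes.OSLegsFromFemtoAndGap.DlrCollarTransfer.StubLower.norm_timeReflection_sub_single]
    at hu
  rw [dist_eq_norm] at hw
  have hpp : ‖p + p‖ = 2 * t₀ := by
    rw [← two_smul ℝ p, norm_smul, hp, norm_single_zero, Real.norm_of_nonneg (by norm_num : (0:ℝ) ≤ 2),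
      abs_of_nonneg ht₀]
  have e : w - u = (w - p - (u + p)) + (p + p) := by abel
  have h1 : ‖w - p - (u + p)‖ ≤ ‖w - p‖ + ‖u + p‖ := norm_sub_le _ _
  constructor
  · have h2 : ‖p + p‖ ≤ ‖w - u‖ + ‖w - p - (u + p)‖ := by
      have : p + p = (w - u) - (w - p - (u + p)) := by rw [e]; abel
      rw [this]; exact norm_sub_le _ _
    linarith
  · have h2 : ‖w - u‖ ≤ ‖w - p - (u + p)‖ + ‖p + p‖ := by rw [e]; exact norm_add_le _ _
    linarith

/-- Physical separation of two lattice sites at spacing `s ≥ 0`: `s‖y − x‖ = ‖s•y − s•x‖`. [folklore] -/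
theorem mul_norm_siteToE_sub {s : ℝ} (hs : 0 ≤ s) (x y : Fin 4 → ℤ) :
    s * ‖siteToE (y - x)‖ = ‖s • siteToE y - s • siteToE x‖ := by
  rw [← smul_sub, ← siteToE_sub, norm_smul, Real.norm_of_nonneg hs]

/-- A closed ball around `t₀e₀` of radius `< t₀` lies in positive time. [folklore] -/
theorem closedBall_subset_posTime {t₀ R : ℝ} (hR : R < t₀) :
    closedBall (EuclideanSpace.single 0 t₀ : EuclideanSpace ℝ (Fin 4)) R ⊆ {y : EuclideanSpace ℝ (Fin 4) | 0 < y 0} := by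
  intro y hy
  rw [mem_closedBall, dist_eq_norm] at hy
  have h1 := abs_apply_le_norm (y - EuclideanSpace.single 0 t₀) 0
  have h2 : |y 0 - t₀| ≤ R := by simpa using h1.trans hy
  have h3 := (abs_le.1 h2).1
  show 0 < y 0
  linarith

/-- A bump that is `1` at its centre, non-negative and compactly supported has positive mass `‖v‖₁ > 0`. [folklore] -/
theorem integral_abs_pos_of_bump {v : 𝓢(EuclideanSpace ℝ (Fin 4), ℝ)} (hv0 : ∀ z, 0 ≤ v z) {c : EuclideanSpace ℝ (Fin 4)}
    (hvc : v c = 1) {R : ℝ} (hvts : tsupport (v : EuclideanSpace ℝ (Fin 4) → ℝ) = closedBall c R) :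
    0 < ∫ y, |v y| := by
  have e : (fun y => |v y|) = fun y => v y := funext fun y => abs_of_nonneg (hv0 y)
  rw [e]
  have hK : HasCompactSupport (v : EuclideanSpace ℝ (Fin 4) → ℝ) := by
    show IsCompact (tsupport (v : EuclideanSpace ℝ (Fin 4) → ℝ))
    rw [hvts]; exact isCompact_closedBall _ _
  exact v.continuous.integral_pos_of_hasCompactSupport_nonneg_nonzero hK (fun z => hv0 z) (x := c) (by rw [hvc]; norm_num)

end Geometry

/-! ## §3 Clause (i) of `LowerBounds` from the N32T floor (sorry-free) -/

section ClauseOne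

variable (G : Type) [Group G] [TopologicalSpace G] [IsTopologicalGroup G] [CompactSpace G]
  [MeasurableSpace G] [BorelSpace G] (r : LatticeRep G)

/-- **Clause (i) from the volume-uniform pointwise floor.**  A non-negative bump `v` at height `t₀ = (s₀+s₁)/4` with support
radius `(s₁−s₀)/8` charges only pairs inside the window `[s₀, s₁]`; there the floor `ν a⁸ ≤ Cov` holds on every large torus,
and the tree's `PointwiseFloor.q2Floor_of_pointwise_floor` turns it into `ε ≤ Q2(θv, v)` with `ε = ν‖v‖₁²/2`. [folklore] -/
theorem clauseI_of_uniformTwoPointFloor (a : ℝ → ℝ) (ha : ∀ β, 0 < a β) (ha0 : Tendsto a atTop (𝓝 0))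
    (h : UniformTwoPointFloor G r a) :
    ∃ (v : 𝓢(EuclideanSpace ℝ (Fin 4), ℝ)) (ε β₅ Λ₅ : ℝ),
      tsupport v ⊆ {y : EuclideanSpace ℝ (Fin 4) | 0 < y 0} ∧ 0 < ε ∧
        ∀ β : ℝ, β₅ ≤ β → ∀ L : ℕ, Λ₅ ≤ a β * L → ε ≤ Q2 G r β L (a β) (thetaTest 4 v) v := by
  obtain ⟨ν, s₀, s₁, β₅, Λ₅, hν, hs₀, hs₀₁, hfl⟩ := h
  -- the bump: centre `t₀ e₀`, plateau radius `ρ`, support radius `2ρ`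
  set t₀ : ℝ := (s₀ + s₁) / 4 with ht₀
  set ρ : ℝ := (s₁ - s₀) / 16 with hρ
  have hρ0 : 0 < ρ := by rw [hρ]; linarith
  have ht₀0 : 0 ≤ t₀ := by rw [ht₀]; linarith
  obtain ⟨v, hv0, -, hvone, hvsupp, hvts⟩ := exists_bump_schwartz (EuclideanSpace.single 0 t₀) hρ0
  -- positive time and a ball around the origin containing the support
  have hpos : tsupport (v : EuclideanSpace ℝ (Fin 4) → ℝ) ⊆ {y : EuclideanSpace ℝ (Fin 4) | 0 < y 0} := by
    rw [hvts]; exact closedBall_subset_posTime (by rw [ht₀, hρ]; linarith)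
  have hvσ : tsupport (v : EuclideanSpace ℝ (Fin 4) → ℝ) ⊆ closedBall 0 (2 * ρ + t₀) := by
    rw [hvts]
    refine closedBall_subset_closedBall' ?_
    rw [dist_zero_right, norm_single_zero, abs_of_nonneg ht₀0]
  have hv1 : 0 < ∫ y, |v y| :=
    integral_abs_pos_of_bump hv0 (hvone _ (by rw [dist_self]; exact hρ0.le)) hvts
  -- the cloud floor: charged pairs lie in the window
  have hcloud : ∀ β : ℝ, β₅ ≤ β → ∀ L : ℕ, Λ₅ ≤ a β * L → ∀ x ∈ box 4 L, ∀ y ∈ box 4 L,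
      thetaTest 4 v (a β • siteToE x) ≠ 0 → v (a β • siteToE y) ≠ 0 →
        ν * a β ^ 8 ≤ torusE G r β L (fun U => dens G r x U * dens G r y U) -
          torusE G r β L (dens G r x) * torusE G r β L (dens G r y) := by
    intro β hβ L hL x hx y hy hθx hvy
    rw [thetaTest_apply] at hθx
    have hu := hvsupp _ hθx
    have hw := hvsupp _ hvy
    obtain ⟨hlo, hhi⟩ := window_of_near ht₀0 hu hw
    rw [← mul_norm_siteToE_sub (ha β).le] at hlo hhi
    refine hfl β hβ L hL x hx y hy ?_ ?_
    · refine le_trans ?_ hlo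
      rw [ht₀, hρ]; linarith
    · refine hhi.trans ?_
      rw [ht₀, hρ]; linarith
  obtain ⟨ε, β₆, Λ₆, hε, hfloor⟩ :=
    PointwiseFloor.q2Floor_of_pointwise_floor G r a ha ha0 hv0 hv1 hvσ hν hcloud
  exact ⟨v, ε, β₆, Λ₆, hpos, hε, hfloor⟩

end ClauseOne

/-! ## §4 Clause (ii) of `LowerBounds` from the signed three-point floor (sorry-free) -/

section ClauseTwo

variable (G : Type) [Group G] [TopologicalSpace G] [IsTopologicalGroup G] [CompactSpace G]
  [MeasurableSpace G] [BorelSpace G] (r : LatticeRep G)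

/-- **One torus: a signed pointwise floor on the charged cloud of a non-negative triple gives a signed smeared floor.**
If `f, g, h ≥ 0` and every charged triple has `c ≤ sgn·κ₃,T(x,y,z)`, then `c · S_f S_g S_h ≤ sgn · Q3_{β,L,s}(f,g,h)`
(`S_f = Σ_{x ∈ box L} f(s x)`). [folklore] -/
theorem sgn_mul_Q3_ge_of_pointwise_floor_at (β : ℝ) (L : ℕ) (s sgn : ℝ) {f g h : 𝓢(EuclideanSpace ℝ (Fin 4), ℝ)}
    (hf : ∀ u, 0 ≤ f u) (hg : ∀ u, 0 ≤ g u) (hh : ∀ u, 0 ≤ h u) {c : ℝ}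
    (hc : ∀ x ∈ box 4 L, ∀ y ∈ box 4 L, ∀ z ∈ box 4 L,
      f (s • siteToE x) ≠ 0 → g (s • siteToE y) ≠ 0 → h (s • siteToE z) ≠ 0 → c ≤ sgn * torusK3 G r β L x y z) :
    c * ((∑ x ∈ box 4 L, f (s • siteToE x)) * (∑ y ∈ box 4 L, g (s • siteToE y)) *
      (∑ z ∈ box 4 L, h (s • siteToE z))) ≤ sgn * Q3 G r β L s f g h := by
  have e : (∑ x ∈ box 4 L, f (s • siteToE x)) * (∑ y ∈ box 4 L, g (s • siteToE y)) *
      (∑ z ∈ box 4 L, h (s • siteToE z)) =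
      ∑ x ∈ box 4 L, ∑ y ∈ box 4 L, ∑ z ∈ box 4 L, f (s • siteToE x) * g (s • siteToE y) * h (s • siteToE z) := by
    rw [Finset.sum_mul_sum, Finset.sum_mul]
    refine Finset.sum_congr rfl fun x _ => ?_
    rw [Finset.sum_mul_sum]
  rw [e, Finset.mul_sum]
  unfold Q3
  rw [Finset.mul_sum]
  refine Finset.sum_le_sum fun x hx => ?_
  rw [Finset.mul_sum, Finset.mul_sum]
  refine Finset.sum_le_sum fun y hy => ?_
  rw [Finset.mul_sum, Finset.mul_sum]
  refine Finset.sum_le_sum fun z hz => ?_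
  by_cases hfx : f (s • siteToE x) = 0
  · simp [hfx]
  by_cases hgy : g (s • siteToE y) = 0
  · simp [hgy]
  by_cases hhz : h (s • siteToE z) = 0
  · simp [hhz]
  have hw : 0 ≤ f (s • siteToE x) * g (s • siteToE y) * h (s • siteToE z) :=
    mul_nonneg (mul_nonneg (hf _) (hg _)) (hh _)
  calc c * (f (s • siteToE x) * g (s • siteToE y) * h (s • siteToE z))
      = f (s • siteToE x) * g (s • siteToE y) * h (s • siteToE z) * c := by ring
    _ ≤ f (s • siteToE x) * g (s • siteToE y) * h (s • siteToE z) * (sgn * torusK3 G r β L x y z) :=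
        mul_le_mul_of_nonneg_left (hc x hx y hy z hz hfx hgy hhz) hw
    _ = sgn * (f (s • siteToE x) * g (s • siteToE y) * h (s • siteToE z) * torusK3 G r β L x y z) := by ring

/-- **Clause (ii) from the signed volume-uniform three-point floor.**  Three non-negative bumps of support radius `ρ` around
`p₁, p₂, p₃` (pairwise disjoint supports) charge only triples of the cloud; the signed floor `ν₃ a¹² ≤ sgn·κ₃` and the
Riemann envelopes `a⁴Σf → ‖f‖₁` give `|Q3(f,g,h)| ≥ sgn·Q3 ≥ ν₃‖f‖₁‖g‖₁‖h‖₁/2 > 0` on every large torus. [folklore] -/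
theorem clauseII_of_uniformThreePointFloor (a : ℝ → ℝ) (ha : ∀ β, 0 < a β) (ha0 : Tendsto a atTop (𝓝 0))
    (h3 : UniformThreePointFloor G r a) :
    ∃ (f g h : 𝓢(EuclideanSpace ℝ (Fin 4), ℝ)) (ε β₅ Λ₅ : ℝ),
      Disjoint (tsupport f) (tsupport g) ∧ Disjoint (tsupport g) (tsupport h) ∧ Disjoint (tsupport f) (tsupport h) ∧
        0 < ε ∧ ∀ β : ℝ, β₅ ≤ β → ∀ L : ℕ, Λ₅ ≤ a β * L → ε ≤ |Q3 G r β L (a β) f g h| := by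
  obtain ⟨p₁, p₂, p₃, ρ, ν₃, sgn, β₅, Λ₅, hρ, h12, h23, h13, hν₃, hsgn, hfl⟩ := h3
  have hρ2 : 0 < ρ / 2 := by positivity
  have eρ : 2 * (ρ / 2) = ρ := by ring
  obtain ⟨f, hf0, -, hfone, hfsupp, hfts⟩ := exists_bump_schwartz p₁ hρ2
  obtain ⟨g, hg0, -, hgone, hgsupp, hgts⟩ := exists_bump_schwartz p₂ hρ2
  obtain ⟨h, hh0, -, hhone, hhsupp, hhts⟩ := exists_bump_schwartz p₃ hρ2
  rw [eρ] at hfsupp hfts hgsupp hgts hhsupp hhts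
  -- disjoint supports
  have hfg : Disjoint (tsupport (f : EuclideanSpace ℝ (Fin 4) → ℝ)) (tsupport (g : EuclideanSpace ℝ (Fin 4) → ℝ)) := by
    rw [hfts, hgts]; exact closedBall_disjoint_closedBall (by linarith)
  have hgh : Disjoint (tsupport (g : EuclideanSpace ℝ (Fin 4) → ℝ)) (tsupport (h : EuclideanSpace ℝ (Fin 4) → ℝ)) := by
    rw [hgts, hhts]; exact closedBall_disjoint_closedBall (by linarith)
  have hfh : Disjoint (tsupport (f : EuclideanSpace ℝ (Fin 4) → ℝ)) (tsupport (h : EuclideanSpace ℝ (Fin 4) → ℝ)) := by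
    rw [hfts, hhts]; exact closedBall_disjoint_closedBall (by linarith)
  -- one ball around the origin containing the three supports
  set σ : ℝ := ‖p₁‖ + ‖p₂‖ + ‖p₃‖ + ρ with hσ
  have hfσ : tsupport (f : EuclideanSpace ℝ (Fin 4) → ℝ) ⊆ closedBall 0 σ := by
    rw [hfts]; refine closedBall_subset_closedBall' ?_
    rw [dist_zero_right, hσ]; linarith [norm_nonneg p₂, norm_nonneg p₃]
  have hgσ : tsupport (g : EuclideanSpace ℝ (Fin 4) → ℝ) ⊆ closedBall 0 σ := by
    rw [hgts]; refine closedBall_subset_closedBall' ?_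
    rw [dist_zero_right, hσ]; linarith [norm_nonneg p₁, norm_nonneg p₃]
  have hhσ : tsupport (h : EuclideanSpace ℝ (Fin 4) → ℝ) ⊆ closedBall 0 σ := by
    rw [hhts]; refine closedBall_subset_closedBall' ?_
    rw [dist_zero_right, hσ]; linarith [norm_nonneg p₁, norm_nonneg p₂]
  -- positive masses
  have hf1 : 0 < ∫ y, |f y| := integral_abs_pos_of_bump hf0 (hfone _ (by rw [dist_self]; exact hρ2.le)) hfts
  have hg1 : 0 < ∫ y, |g y| := integral_abs_pos_of_bump hg0 (hgone _ (by rw [dist_self]; exact hρ2.le)) hgts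
  have hh1 : 0 < ∫ y, |h y| := integral_abs_pos_of_bump hh0 (hhone _ (by rw [dist_self]; exact hρ2.le)) hhts
  -- reference boxes covering the supports and the Riemann envelopes
  set L₁ : ℝ → ℕ := fun β => ⌈σ / a β⌉₊ with hL₁
  have hL₁σ : ∀ β, σ ≤ a β * L₁ β := fun β => by
    have h1 : σ / a β ≤ L₁ β := Nat.le_ceil _
    calc σ = a β * (σ / a β) := by field_simp [(ha β).ne']
      _ ≤ a β * L₁ β := mul_le_mul_of_nonneg_left h1 (ha β).le
  have hcov : ∀ β (L : ℕ), σ ≤ a β * L → L₁ β ≤ L := fun β L hL => by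
    refine Nat.ceil_le.2 ?_
    rw [div_le_iff₀ (ha β), mul_comm]
    exact hL
  have hlim := ((CeilingPrice.tendsto_envelope f hfσ a L₁ ha ha0 (Eventually.of_forall hL₁σ)).mul
    (CeilingPrice.tendsto_envelope g hgσ a L₁ ha ha0 (Eventually.of_forall hL₁σ))).mul
    (CeilingPrice.tendsto_envelope h hhσ a L₁ ha ha0 (Eventually.of_forall hL₁σ))
  have hP : 0 < (∫ y, |f y|) * (∫ y, |g y|) * (∫ y, |h y|) := mul_pos (mul_pos hf1 hg1) hh1
  have hhalf : (∫ y, |f y|) * (∫ y, |g y|) * (∫ y, |h y|) / 2 < (∫ y, |f y|) * (∫ y, |g y|) * (∫ y, |h y|) := by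
    linarith
  obtain ⟨β₆, hβ₆⟩ := ((hlim.eventually (lt_mem_nhds hhalf)).and (eventually_ge_atTop β₅)).exists_forall_of_atTop
  refine ⟨f, g, h, ν₃ * ((∫ y, |f y|) * (∫ y, |g y|) * (∫ y, |h y|) / 2), β₆, max Λ₅ σ, hfg, hgh, hfh, by positivity,
    fun β hβ L hL => ?_⟩
  obtain ⟨hPβ, hβ5⟩ := hβ₆ β hβ
  have hΛ : Λ₅ ≤ a β * L := (le_max_left _ _).trans hL
  have hσL : σ ≤ a β * L := (le_max_right _ _).trans hL
  -- the signed one-torus floor on the charged cloud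
  have hq := sgn_mul_Q3_ge_of_pointwise_floor_at G r β L (a β) sgn hf0 hg0 hh0 (c := ν₃ * a β ^ 12)
    (fun x hx y hy z hz hfx hgy hhz => hfl β hβ5 L hΛ x hx y hy z hz
      (mem_closedBall.2 (hfsupp _ hfx).le) (mem_closedBall.2 (hgsupp _ hgy).le) (mem_closedBall.2 (hhsupp _ hhz).le))
  -- envelope sums: drop the absolute values, move to the reference box
  have hfabs : ∑ x ∈ box 4 L, f (a β • siteToE x) = ∑ x ∈ box 4 L, |f (a β • siteToE x)| :=
    Finset.sum_congr rfl fun x _ => (abs_of_nonneg (hf0 _)).symm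
  have hgabs : ∑ y ∈ box 4 L, g (a β • siteToE y) = ∑ y ∈ box 4 L, |g (a β • siteToE y)| :=
    Finset.sum_congr rfl fun y _ => (abs_of_nonneg (hg0 _)).symm
  have hhabs : ∑ z ∈ box 4 L, h (a β • siteToE z) = ∑ z ∈ box 4 L, |h (a β • siteToE z)| :=
    Finset.sum_congr rfl fun z _ => (abs_of_nonneg (hh0 _)).symm
  have hfeq := CeilingPrice.sum_box_eq_sum_box_of_cover (φ := fun u => |f u|) (ha β)
    (CeilingPrice.tsupport_abs_subset hfσ) (hL₁σ β) (hcov β L hσL)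
  have hgeq := CeilingPrice.sum_box_eq_sum_box_of_cover (φ := fun u => |g u|) (ha β)
    (CeilingPrice.tsupport_abs_subset hgσ) (hL₁σ β) (hcov β L hσL)
  have hheq := CeilingPrice.sum_box_eq_sum_box_of_cover (φ := fun u => |h u|) (ha β)
    (CeilingPrice.tsupport_abs_subset hhσ) (hL₁σ β) (hcov β L hσL)
  rw [hfabs, hgabs, hhabs, hfeq, hgeq, hheq] at hq
  have e : ν₃ * a β ^ 12 * ((∑ x ∈ box 4 (L₁ β), |f (a β • siteToE x)|) *
      (∑ y ∈ box 4 (L₁ β), |g (a β • siteToE y)|) * (∑ z ∈ box 4 (L₁ β), |h (a β • siteToE z)|)) =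
      ν₃ * ((a β ^ 4 * ∑ x ∈ box 4 (L₁ β), |f (a β • siteToE x)|) *
        (a β ^ 4 * ∑ y ∈ box 4 (L₁ β), |g (a β • siteToE y)|) * (a β ^ 4 * ∑ z ∈ box 4 (L₁ β), |h (a β • siteToE z)|)) := by
    ring
  rw [e] at hq
  have habs : sgn * Q3 G r β L (a β) f g h ≤ |Q3 G r β L (a β) f g h| := by
    rcases hsgn with h1 | h1 <;> rw [h1]
    · rw [one_mul]; exact le_abs_self _
    · rw [neg_one_mul]; exact neg_le_abs _
  refine le_trans ?_ (hq.trans habs)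
  have := mul_le_mul_of_nonneg_left hPβ.le hν₃.le
  linarith

end ClauseTwo

/-! ## §5 The composition: the stubs give the crux BY NAME (sorry-free) -/

section Compose

variable (G : Type) [Group G] [TopologicalSpace G] [IsTopologicalGroup G] [CompactSpace G]
  [MeasurableSpace G] [BorelSpace G] (r : LatticeRep G)

/-- `LowerBounds G r a` from the two volume-uniform floors in the same units. [folklore] -/
theorem lowerBounds_of_floors (a : ℝ → ℝ) (ha : ∀ β, 0 < a β) (ha0 : Tendsto a atTop (𝓝 0))
    (h2 : UniformTwoPointFloor G r a) (h3 : UniformThreePointFloor G r a) : LowerBounds G r a :=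
  ⟨clauseI_of_uniformTwoPointFloor G r a ha ha0 h2, clauseII_of_uniformThreePointFloor G r a ha ha0 h3⟩

end Compose

/-- **THE COMPOSITION `NT_of : N32T → K3T → NT`** — the two stubs give the crux `BalabanLadder.NT` BY NAME; no smuggled
input (the glue of §§2–4 is proved above over tree theorems). -/
theorem NT_of (h1 : N32T) (h2 : K3T) : Summit.QuantumFields.YangMills.Theses.BalabanLadder.NT := by
  intro G _ _ _ _ hG
  letI : MeasurableSpace G := borel G
  haveI : BorelSpace G := ⟨rfl⟩
  obtain ⟨r, a, ha, ha0, hfl2⟩ := h1 G hG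
  have hfl3 := h2 G hG r a ha ha0 hfl2
  exact ⟨r, a, ha, ha0, lowerBounds_of_floors G r a ha ha0 hfl2 hfl3⟩

end Summit.QuantumFields.YangMills.Cruxes.NT.N32Floors

end
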